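import Mathlib
import Summits.CriticalPhenomena.Ising3DConformalLimit.Theorems.PrecisionLaplacianEtaBoundsTransferTrig
import Summits.CriticalPhenomena.Ising3DConformalLimit.Theorems.PrecisionLaplacianEtaBoundsTransferFourier
import HarnessLib

/-!
# TwoPointSpineGlue (route PrecisionLaplacian, item stmt-CriticalPhenomena-4805) — the symbol lower bound
# `ψ(k) ≥ c ‖k‖^α` from heavy boxes

Helper file 5.  For nonnegative summable step weights `b` on `ℤᵈ`, the symbol
`ψ(k) = ∑_y b(y) (1 − cos(k·y))` controls the infrared behaviour of the walk.  The `EtaBoundsTransfer`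
helper `psi_lower` derives `ψ(k) ≥ c‖k‖^α` on the Brillouin zone from a pointwise lower bound
`b(y) ≥ c‖y‖^{-(d+α)}` at EVERY site.  Under the hypotheses of `TwoPointSpineGlue` the tail profile
`Φ ≥ 0` may vanish on part of the sphere, and only HEAVY BOXES are available: for every scale `L ≥ L₀`
a box `c_L + Λ_L` on which `b ≥ c L^{-(d+α)}` (boxes along a ray where `Φ > 0`).  This file proves the
symbol lower bound in that generality:

* `abs_sum_box_cos_phase_add_le`, `sum_box_one_sub_cos_add_ge` — the counting estimate
  `∑_{u ∈ Λ_L} (1 − cos(k·(c+u))) ≥ L^d` for `L ≥ π/‖k‖` survives an arbitrary shift `c` (the shifted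
  character sum is still bounded by `∏ |D_L(k_j)|`);
* `psi_lower_of_boxes_small` — `ψ(k) ≥ c(2π)^{-α}‖k‖^α` for `‖k‖ ≤ π/L₀`;
* `psi_pos` — `ψ(k) > 0` on the punctured zone as soon as `b > 0` at some `y₁` and at `y₁ + eᵢ` for
  all `i` (aperiodicity); `psi_lower_of_boxes` — the bound on the whole punctured zone (compactness on
  the annulus `π/L₀ ≤ ‖k‖ ≤ π`);

The heavy boxes themselves are produced from the route's TAIL profile in `…TwoPointSpineGlueHeavyBoxes`.

No definitions are introduced.  References: F. Spitzer, *Principles of Random Walk* (1976), §7 (P7.5,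
aperiodicity and the symbol); G. Lawler, V. Limic (2010), §2.3.
-/

noncomputable section

namespace Summit.CriticalPhenomena.Ising3DConformalLimit.Theorems.SpineGlue

open Finset Real Filter Topology Literature.Probability.LatticeModels
open Literature.Barriers.CriticalPhenomena Literature.Barriers.CriticalPhenomena.SpreadOutIsing
open Summit.CriticalPhenomena.Ising3DConformalLimit.Theorems.EtaBoundsTransfer

section Shifted

variable {d : ℕ}

/-- **Shifted character sums are bounded by the Dirichlet product**:
`|∑_{u ∈ Λ_L} cos(k·(c + u))| ≤ |∏_j D_L(k_j)|` (the modulus of `e^{ik·c} ∏_j D_L(k_j)`). -/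
theorem abs_sum_box_cos_phase_add_le (L : ℕ) (k : Fin d → ℝ) (c : Site d) :
    |∑ u ∈ box d L, Real.cos (phase d k (c + u))| ≤ |∏ j : Fin d, dirichletRowSum L (k j)| := by
  have h := sq_sum_cos_add_sq_sum_sin (box d L) (fun u => phase d k (c + u))
  have h2 : ∑ y ∈ box d L, ∑ y' ∈ box d L, Real.cos (phase d k (c + y) - phase d k (c + y'))
      = (∏ j : Fin d, dirichletRowSum L (k j)) ^ 2 := by
    rw [← sum_box_box_cos_phase_sub L k]
    refine Finset.sum_congr rfl fun y _ => Finset.sum_congr rfl fun y' _ => ?_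
    rw [phase_sub, phase_add, phase_add]
    ring_nf
  rw [h2] at h
  have h3 : (∑ u ∈ box d L, Real.cos (phase d k (c + u))) ^ 2 ≤ (∏ j : Fin d, dirichletRowSum L (k j)) ^ 2 := by
    nlinarith [sq_nonneg (∑ u ∈ box d L, Real.sin (phase d k (c + u)))]
  exact sq_le_sq.1 h3

/-- **Counting estimate on a shifted box**: for `k ∈ [-π,π]^d ∖ 0` and `L ≥ π/‖k‖`,
`∑_{u ∈ Λ_L} (1 − cos(k·(c + u))) ≥ L^d` for every shift `c`. -/
theorem sum_box_one_sub_cos_add_ge (hd : 1 ≤ d) {k : Fin d → ℝ} (hk : ‖k‖ ≤ π) (hk0 : k ≠ 0)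
    {L : ℕ} (hL : π / ‖k‖ ≤ L) (c : Site d) :
    (L : ℝ) ^ d ≤ ∑ u ∈ box d L, (1 - Real.cos (phase d k (c + u))) := by
  have hnk : 0 < ‖k‖ := norm_pos_iff.2 hk0
  obtain ⟨j₀, hj₀⟩ := LongRangeIsing.exists_abs_eq_norm hd k
  have hkj : ∀ j, |k j| ≤ π := fun j => by
    have := norm_le_pi_norm k j; rw [Real.norm_eq_abs] at this; exact this.trans hk
  have hkj₀ : k j₀ ≠ 0 := by
    intro h; rw [h, abs_zero] at hj₀; exact hnk.ne' hj₀.symm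
  rw [Finset.sum_sub_distrib, Finset.sum_const, card_box, nsmul_eq_mul, mul_one]
  push_cast
  -- bound the shifted character sum by the product of Dirichlet kernels
  have hprod : ∑ u ∈ box d L, Real.cos (phase d k (c + u)) ≤ (2 * L + 1 : ℝ) ^ (d - 1) * (π / ‖k‖) := by
    refine le_trans (le_abs_self _) ((abs_sum_box_cos_phase_add_le L k c).trans ?_)
    rw [Finset.abs_prod, ← Finset.prod_erase_mul _ _ (Finset.mem_univ j₀)]
    have h1 : ∏ j ∈ Finset.univ.erase j₀, |dirichletRowSum L (k j)| ≤ (2 * L + 1 : ℝ) ^ (d - 1) := by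
      calc ∏ j ∈ Finset.univ.erase j₀, |dirichletRowSum L (k j)|
          ≤ ∏ j ∈ Finset.univ.erase j₀, (2 * L + 1 : ℝ) :=
            Finset.prod_le_prod (fun j _ => abs_nonneg _) fun j _ => abs_dirichletRowSum_le L (k j)
        _ = (2 * L + 1 : ℝ) ^ (d - 1) := by
            rw [Finset.prod_const, Finset.card_erase_of_mem (Finset.mem_univ j₀),
              Finset.card_univ, Fintype.card_fin]
    have h2 : |dirichletRowSum L (k j₀)| ≤ π / ‖k‖ := by
      rw [← hj₀]; exact abs_dirichletRowSum_le_pi_div L hkj₀ (hkj j₀)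
    exact mul_le_mul h1 h2 (abs_nonneg _) (by positivity)
  have hL0 : (0 : ℝ) ≤ L := Nat.cast_nonneg L
  have hd1 : d = (d - 1) + 1 := (Nat.sub_add_cancel hd).symm
  have hpow : (2 * L + 1 : ℝ) ^ d = (2 * L + 1 : ℝ) ^ (d - 1) * (2 * L + 1) := by
    conv_lhs => rw [hd1]
    rw [pow_succ]
  rw [hpow]
  have h3 : (L : ℝ) ^ d ≤ (2 * L + 1 : ℝ) ^ (d - 1) * ((2 * L + 1) - π / ‖k‖) := by
    calc (L : ℝ) ^ d = (L : ℝ) ^ (d - 1) * L := by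
          conv_lhs => rw [hd1]
          rw [pow_succ]
      _ ≤ (2 * L + 1 : ℝ) ^ (d - 1) * ((2 * L + 1) - π / ‖k‖) := by
          apply mul_le_mul (pow_le_pow_left₀ hL0 (by linarith) _) (by linarith)
            hL0 (by positivity)
  nlinarith [h3, hprod, pow_nonneg (show (0:ℝ) ≤ 2 * L + 1 by positivity) (d - 1)]

end Shifted

section Psi

variable {d : ℕ}

/-- Summability and termwise nonnegativity of the symbol series. -/
theorem summable_symbol {b : Site d → ℝ} (hb0 : ∀ y, 0 ≤ b y) (hbs : Summable b) (k : Fin d → ℝ) :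
    (∀ y, 0 ≤ b y * (1 - Real.cos (phase d k y))) ∧
      Summable (fun y => b y * (1 - Real.cos (phase d k y))) := by
  have hnn : ∀ y, 0 ≤ b y * (1 - Real.cos (phase d k y)) :=
    fun y => mul_nonneg (hb0 y) (by linarith [Real.cos_le_one (phase d k y)])
  exact ⟨hnn, Summable.of_nonneg_of_le hnn
    (fun y => mul_le_mul_of_nonneg_left (by linarith [Real.neg_one_le_cos (phase d k y)]) (hb0 y))
    (hbs.mul_right 2)⟩

/-- **Symbol lower bound near the origin from heavy boxes**: if for every `L ≥ L₀` the step weights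
satisfy `b ≥ c L^{-(d+α)}` on some box `c_L + Λ_L`, then `ψ(k) ≥ c (2π)^{-α} ‖k‖^α` for
`0 < ‖k‖ ≤ π` with `π/‖k‖ ≥ L₀`. -/
theorem psi_lower_of_boxes_small (hd : 1 ≤ d) {b : Site d → ℝ} {c α : ℝ} (hc : 0 < c) (hα : 0 < α)
    (hb0 : ∀ y, 0 ≤ b y) (hbs : Summable b) {L₀ : ℕ} (ctr : ℕ → Site d)
    (hlow : ∀ L : ℕ, L₀ ≤ L → ∀ u ∈ box d L, c * (L : ℝ) ^ (-((d : ℝ) + α)) ≤ b (ctr L + u))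
    {k : Fin d → ℝ} (hk : ‖k‖ ≤ π) (hk0 : k ≠ 0) (hkL : (L₀ : ℝ) ≤ π / ‖k‖) :
    c * (2 * π) ^ (-α) * ‖k‖ ^ α ≤ ∑' y, b y * (1 - Real.cos (phase d k y)) := by
  have hπ := Real.pi_pos
  have hnk : 0 < ‖k‖ := norm_pos_iff.2 hk0
  have hge1 : 1 ≤ π / ‖k‖ := by rw [le_div_iff₀ hnk]; linarith
  set L : ℕ := ⌈π / ‖k‖⌉₊ with hLdef
  have hLge : π / ‖k‖ ≤ L := Nat.le_ceil _
  have hLpos : (0 : ℝ) < L := lt_of_lt_of_le (by positivity) hLge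
  have hLle : (L : ℝ) ≤ 2 * π / ‖k‖ := by
    have h1 : (L : ℝ) < π / ‖k‖ + 1 := Nat.ceil_lt_add_one (by positivity)
    have h2 : π / ‖k‖ + 1 ≤ 2 * π / ‖k‖ := by rw [two_mul, add_div]; linarith
    linarith
  have hL₀ : L₀ ≤ L := by
    have : (L₀ : ℝ) ≤ L := hkL.trans hLge
    exact_mod_cast this
  obtain ⟨hnn, hsum⟩ := summable_symbol hb0 hbs k
  -- restriction to the shifted box (an injective image of `Λ_L`)
  set B : Finset (Site d) := (box d L).map (addLeftEmbedding (ctr L)) with hB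
  have hstep1 : ∑ y ∈ B, b y * (1 - Real.cos (phase d k y)) ≤ ∑' y, b y * (1 - Real.cos (phase d k y)) :=
    hsum.sum_le_tsum B (fun y _ => hnn y)
  have hstep1' : ∑ y ∈ B, b y * (1 - Real.cos (phase d k y))
      = ∑ u ∈ box d L, b (ctr L + u) * (1 - Real.cos (phase d k (ctr L + u))) := by
    rw [hB, Finset.sum_map]
    rfl
  -- pointwise lower bound on the box
  have hstep2 : ∑ u ∈ box d L, c * (L : ℝ) ^ (-((d : ℝ) + α)) * (1 - Real.cos (phase d k (ctr L + u)))
      ≤ ∑ u ∈ box d L, b (ctr L + u) * (1 - Real.cos (phase d k (ctr L + u))) := by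
    apply Finset.sum_le_sum
    intro u hu
    exact mul_le_mul_of_nonneg_right (hlow L hL₀ u hu) (by linarith [Real.cos_le_one (phase d k (ctr L + u))])
  rw [← Finset.mul_sum] at hstep2
  have hstep3 := sum_box_one_sub_cos_add_ge hd hk hk0 hLge (ctr L)
  -- assemble: `c L^{-(d+α)} L^d = c L^{-α} ≥ c (2π/‖k‖)^{-α}`
  have hLpow : c * (L : ℝ) ^ (-((d : ℝ) + α)) * (L : ℝ) ^ d = c * (L : ℝ) ^ (-α) := by
    rw [show -((d : ℝ) + α) = -α + -(d : ℝ) by ring, Real.rpow_add hLpos, Real.rpow_neg hLpos.le (d : ℝ),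
      Real.rpow_natCast]
    field_simp
  have hkpow : (2 * π) ^ (-α) * ‖k‖ ^ α ≤ (L : ℝ) ^ (-α) := by
    have h1 : (L : ℝ) ^ (-α) ≥ (2 * π / ‖k‖) ^ (-α) :=
      Real.rpow_le_rpow_of_nonpos hLpos hLle (by linarith)
    rw [Real.div_rpow (by positivity) hnk.le, Real.rpow_neg hnk.le, div_inv_eq_mul] at h1
    exact h1
  calc c * (2 * π) ^ (-α) * ‖k‖ ^ α = c * ((2 * π) ^ (-α) * ‖k‖ ^ α) := by ring
    _ ≤ c * (L : ℝ) ^ (-α) := mul_le_mul_of_nonneg_left hkpow hc.le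
    _ = c * (L : ℝ) ^ (-((d : ℝ) + α)) * (L : ℝ) ^ d := hLpow.symm
    _ ≤ c * (L : ℝ) ^ (-((d : ℝ) + α)) * ∑ u ∈ box d L, (1 - Real.cos (phase d k (ctr L + u))) :=
        mul_le_mul_of_nonneg_left hstep3 (by positivity)
    _ ≤ ∑ u ∈ box d L, b (ctr L + u) * (1 - Real.cos (phase d k (ctr L + u))) := hstep2
    _ = ∑ y ∈ B, b y * (1 - Real.cos (phase d k y)) := hstep1'.symm
    _ ≤ _ := hstep1

/-- **Aperiodicity**: if `b > 0` at a site `y₁` and at `y₁ + eᵢ` for every `i`, then the symbol is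
positive on the punctured Brillouin zone: `ψ(k) > 0` for `k ∈ [-π,π]^d`, `k ≠ 0` (a zero of `ψ` forces
`cos(k·y₁) = cos(k·y₁ + kᵢ) = 1`, hence `kᵢ ∈ 2πℤ ∩ [-π,π] = {0}`). -/
theorem psi_pos {b : Site d → ℝ} (hb0 : ∀ y, 0 ≤ b y) (hbs : Summable b) (y₁ : Site d)
    (hy₁ : 0 < b y₁) (hy₁' : ∀ i : Fin d, 0 < b (y₁ + Pi.single i 1))
    {k : Fin d → ℝ} (hk : ‖k‖ ≤ π) (hk0 : k ≠ 0) :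
    0 < ∑' y, b y * (1 - Real.cos (phase d k y)) := by
  obtain ⟨hnn, hsum⟩ := summable_symbol hb0 hbs k
  refine lt_of_le_of_ne (tsum_nonneg hnn) fun h0 => hk0 ?_
  have hzero := (hasSum_zero_iff_of_nonneg hnn).1 (by rw [h0]; exact hsum.hasSum)
  have hcos : ∀ y, 0 < b y → Real.cos (phase d k y) = 1 := by
    intro y hy
    have := congr_fun hzero y
    simp only [Pi.zero_apply, mul_eq_zero] at this
    rcases this with h1 | h1
    · exact absurd h1 hy.ne'
    · linarith
  obtain ⟨m, hm⟩ := (Real.cos_eq_one_iff _).1 (hcos y₁ hy₁)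
  funext i
  obtain ⟨m', hm'⟩ := (Real.cos_eq_one_iff _).1 (hcos _ (hy₁' i))
  have hki : k i = (m' - m : ℤ) * (2 * π) := by
    have h1 : phase d k (y₁ + Pi.single i 1) = phase d k y₁ + k i := by
      rw [phase_add]
      simp [phase, Pi.single_apply]
    rw [h1, ← hm] at hm'
    push_cast
    linarith
  have habs : |k i| ≤ π := by
    have := norm_le_pi_norm k i; rw [Real.norm_eq_abs] at this; exact this.trans hk
  have hint : (m' - m : ℤ) = 0 := by
    by_contra hne
    have h1 : (1 : ℝ) ≤ |((m' - m : ℤ) : ℝ)| := by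
      rw [← Int.cast_abs]; exact_mod_cast Int.one_le_abs hne
    have h2 : |k i| = |((m' - m : ℤ) : ℝ)| * (2 * π) := by
      rw [hki, abs_mul, abs_of_pos (show (0 : ℝ) < 2 * π by positivity)]
    have : 2 * π ≤ |k i| := by rw [h2]; nlinarith [Real.pi_pos]
    linarith [Real.pi_pos]
  rw [hki, hint]
  simp

/-- The symbol is continuous. -/
theorem continuous_symbol {b : Site d → ℝ} (hb0 : ∀ y, 0 ≤ b y) (hbs : Summable b) :
    Continuous fun k : Fin d → ℝ => ∑' y, b y * (1 - Real.cos (phase d k y)) := by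
  have h1 : ∀ k : Fin d → ℝ, ∑' y, b y * (1 - Real.cos (phase d k y))
      = ∑' y, b y - ∑' y, b y * Real.cos (phase d k y) := by
    intro k
    have hsc : Summable fun y => b y * Real.cos (phase d k y) :=
      Summable.of_norm_bounded hbs fun y => by
        rw [Real.norm_eq_abs, abs_mul, abs_of_nonneg (hb0 y)]
        exact mul_le_of_le_one_right (hb0 y) (Real.abs_cos_le_one _)
    rw [← hbs.tsum_sub hsc]
    exact tsum_congr fun y => by ring
  simp_rw [h1]
  exact continuous_const.sub (continuous_fourier_q hbs)

/-- **Symbol lower bound on the whole punctured zone from heavy boxes**: given heavy boxes for all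
scales `L ≥ L₀` (with `L₀ ≥ 1`, so that `b > 0` at `c_{L₀}` and its neighbours `c_{L₀} + eᵢ`), there is
`c₁ > 0` with `ψ(k) ≥ c₁ ‖k‖^α` for all `0 < ‖k‖ ≤ π` (near the origin by counting, on the annulus
`π/L₀ ≤ ‖k‖ ≤ π` by positivity and compactness). -/
theorem psi_lower_of_boxes (hd : 1 ≤ d) {b : Site d → ℝ} {c α : ℝ} (hc : 0 < c) (hα : 0 < α)
    (hb0 : ∀ y, 0 ≤ b y) (hbs : Summable b) {L₀ : ℕ} (hL₀ : 1 ≤ L₀) (ctr : ℕ → Site d)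
    (hlow : ∀ L : ℕ, L₀ ≤ L → ∀ u ∈ box d L, c * (L : ℝ) ^ (-((d : ℝ) + α)) ≤ b (ctr L + u)) :
    ∃ c₁ : ℝ, 0 < c₁ ∧ ∀ k : Fin d → ℝ, ‖k‖ ≤ π → k ≠ 0 →
      c₁ * ‖k‖ ^ α ≤ ∑' y, b y * (1 - Real.cos (phase d k y)) := by
  have hπ := Real.pi_pos
  set ψ : (Fin d → ℝ) → ℝ := fun k => ∑' y, b y * (1 - Real.cos (phase d k y)) with hψ
  -- positivity on the punctured zone
  have hL₀pos : (0 : ℝ) < L₀ := by exact_mod_cast hL₀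
  have hbL : ∀ u ∈ box d L₀, 0 < b (ctr L₀ + u) := fun u hu =>
    lt_of_lt_of_le (mul_pos hc (Real.rpow_pos_of_pos hL₀pos _)) (hlow L₀ le_rfl u hu)
  have hpos : ∀ k : Fin d → ℝ, ‖k‖ ≤ π → k ≠ 0 → 0 < ψ k := by
    intro k hk hk0
    refine psi_pos hb0 hbs (ctr L₀) ?_ (fun i => ?_) hk hk0
    · simpa using hbL 0 (zero_mem_box d L₀)
    · refine hbL (Pi.single i 1) (mem_box.2 fun j => ?_)
      by_cases hj : j = i
      · subst hj; simp; exact_mod_cast hL₀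
      · simp [hj]
  -- the annulus `π / L₀ ≤ ‖k‖ ≤ π` is compact
  set A : Set (Fin d → ℝ) := {k | π / L₀ ≤ ‖k‖ ∧ ‖k‖ ≤ π} with hA
  have hAc : IsCompact A := by
    have h1 : A ⊆ Metric.closedBall 0 π := fun k hk => by
      rw [mem_closedBall_zero_iff]; exact hk.2
    refine (isCompact_closedBall (0 : Fin d → ℝ) π).of_isClosed_subset ?_ h1
    exact (isClosed_le continuous_const continuous_norm).inter (isClosed_le continuous_norm continuous_const)
  have hcont : ContinuousOn ψ A := (continuous_symbol hb0 hbs).continuousOn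
  -- a positive lower bound `m` of `ψ` on the annulus
  obtain ⟨m, hm0, hm⟩ : ∃ m : ℝ, 0 < m ∧ ∀ k ∈ A, m ≤ ψ k := by
    by_cases hne : A.Nonempty
    · obtain ⟨k₀, hk₀A, hk₀⟩ := hAc.exists_isMinOn hne hcont
      have hk₀0 : k₀ ≠ 0 := by
        intro h
        have := hk₀A.1
        rw [h, norm_zero] at this
        exact absurd this (not_le.2 (by positivity))
      exact ⟨ψ k₀, hpos k₀ hk₀A.2 hk₀0, fun k hk => hk₀ hk⟩
    · exact ⟨1, one_pos, fun k hk => absurd ⟨k, hk⟩ hne⟩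
  -- the constant
  refine ⟨min (c * (2 * π) ^ (-α)) (m * π ^ (-α)), lt_min (by positivity) (by positivity), ?_⟩
  intro k hk hk0
  have hnk : 0 < ‖k‖ := norm_pos_iff.2 hk0
  by_cases hsmall : (L₀ : ℝ) ≤ π / ‖k‖
  · calc min (c * (2 * π) ^ (-α)) (m * π ^ (-α)) * ‖k‖ ^ α ≤ c * (2 * π) ^ (-α) * ‖k‖ ^ α :=
          mul_le_mul_of_nonneg_right (min_le_left _ _) (by positivity)
      _ ≤ ψ k := psi_lower_of_boxes_small hd hc hα hb0 hbs ctr hlow hk hk0 hsmall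
  · have hkA : k ∈ A := by
      refine ⟨?_, hk⟩
      rw [not_le, div_lt_iff₀ hnk] at hsmall
      rw [div_le_iff₀ hL₀pos]
      linarith [mul_comm (L₀ : ℝ) ‖k‖]
    have h1 : ‖k‖ ^ α ≤ π ^ α := Real.rpow_le_rpow hnk.le hk hα.le
    calc min (c * (2 * π) ^ (-α)) (m * π ^ (-α)) * ‖k‖ ^ α ≤ m * π ^ (-α) * ‖k‖ ^ α :=
          mul_le_mul_of_nonneg_right (min_le_right _ _) (by positivity)
      _ ≤ m * π ^ (-α) * π ^ α := mul_le_mul_of_nonneg_left h1 (by positivity)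
      _ = m := by rw [mul_assoc, ← Real.rpow_add hπ, neg_add_cancel, Real.rpow_zero, mul_one]
      _ ≤ ψ k := hm k hkA

end Psi


end Summit.CriticalPhenomena.Ising3DConformalLimit.Theorems.SpineGlue

end
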